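import Mathlib

/-!
# Triage scratch (crux-triage r1 k1, stmt-QuantumFields-13897): a finitely supported PSD Hankel kernel is trivial

Supporting `sharpen` note for cards `rp-cone-rigidity` / `cross-plane-hankel-rigidity`: if the cross-plane
weights `c(m)` of a translation orbit vanish beyond some height (height-capped loop / pair families on a torus,
e.g. `Finset.range H` truncation) and the Hankel form `∑ v_a v_{a'} c(a+a')` is positive semidefinite, then
every `c(m)`, `m ≥ 1`, vanishes: a zero diagonal entry of a PSD matrix kills its row, and one inducts down.
Smallest non-trivial instance (3 × 3, support `{0,1,2}`), closed form; the general induction is the same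
2 × 2-minor step. Consequence recorded in TRIAGE: truncated Laplace families `c(m) = r^m 𝟙[m < H]` are NOT
exactly reflection positive on tori — only periodised (cosh) kernels are.
-/

/-- Hankel matrix `[[c0,c1,c2],[c1,c2,0],[c2,0,0]]` positive semidefinite ⇒ `c1 = c2 = 0`. -/
theorem hankel_psd_finite_support_trivial (c0 c1 c2 : ℝ)
    (h : ∀ v0 v1 v2 : ℝ, 0 ≤ c0 * v0 ^ 2 + 2 * c1 * v0 * v1 + 2 * c2 * v0 * v2 + c2 * v1 ^ 2) :
    c1 = 0 ∧ c2 = 0 := by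
  have h2 := h c2 0 (-(c0 + 1) / 2)
  have hc2 : c2 = 0 := by nlinarith [sq_nonneg c2]
  subst hc2
  have h1 := h c1 (-(c0 + 1) / 2) 0
  exact ⟨by nlinarith [sq_nonneg c1], rfl⟩

/-- The link-plane version (weights `c(a+a'+1)`, depths `a, a' ≥ 0`, heights capped at `3`, i.e.
`c 3 = c 4 = … = 0`): `[[c1,c2],[c2,c3]] = [[c1,c2],[c2,0]]` PSD ⇒ `c2 = 0` — the Lüscher–Weisz `1×2` shadow,
and with it every capped family collapses to height `1`. -/
theorem hankel_link_plane_capped (c1 c2 : ℝ)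
    (h : ∀ v0 v1 : ℝ, 0 ≤ c1 * v0 ^ 2 + 2 * c2 * v0 * v1) : c2 = 0 := by
  have := h c2 (-(c1 + 1) / 2)
  nlinarith [sq_nonneg c2]
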